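import Summits.CriticalPhenomena.PercolationContinuityZ3.Theorems.Transplant.SkelPhiCorridorKGValues
import Summits.CriticalPhenomena.PercolationContinuityZ3.Theorems.Transplant.SkelFrmBChoiceNums
import Summits.CriticalPhenomena.PercolationContinuityZ3.Theorems.Transplant.SkelFrmBParamsLF
import Summits.CriticalPhenomena.PercolationContinuityZ3.Theorems.Transplant.SkelFrm1ParamsLBL
import HarnessLib

/-!
# N2 (frames-only node `SamePDropOfSkeletonFrm₁`, OPEN) — (ζ″) ledger, THE K-G CORRIDOR SLOT VALUES INSTANTIATED, FIRST AXIS (E-corridor):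
# the inputs of record `(n, ℓ, hs, v, R′, ρ, q, W, tgt) := (n_L, ℓ_L, h_L, v_L, KS0.R′0, M_u + 1, 2n_L + qx, sL.toNat, pitch + centring)` of p5-g16's
# closed forms (`Skelφ.kgM₁ / kgE₁ / kgWm₂ / kgWp₂ / kgM₂ / kgX / kgCtr2 / kgHw2 / kgN`, SkelPhiCorridorKGValues p350054), the N-free rows
# **`Skelφ.KGRows` DISCHARGED at the values from the numeric long clause `EqNumL` and ONE floor on the box slot `g`** (`kgRows_of`), the run length
# of record `kgNv := kgN … kgTgt` and its bound `kgNv ≤ 20·K + 4` (the (R-34) `Lf` budget input).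

WHAT THIS FILE FIXES (stmt's share of the corridor slots, p5-g16 INBOX 2026-08-23T03:41:13Z / 03:48:18Z, p3-g16 03:36:36Z):
* §1 the INPUTS: `kgR := KS0.R'0 κ Φ t p D mk` (the corridor displacement slot `R′` is the (S0) kit block's level displacement, p5-g16 03:48:18Z (c));
  `kgρ := M_u + 1` (planar radius of the zone datum `Λ c M_u`, ibid.); `kgW Wx := (kgSL n_L ℓ_L h_L).toNat + Wx` (so `hW : sL ≤ 2W` is free; `Wx` = the
  residual for the start-box row `hbW`); `kgq qx := 2·n_L + qx` (`hq : n + |v| ≤ q` is free; `qx` = the residual for the start-box row `haq`); the PITCH `pitch := 20·K·n_L` x′-lattice units (p5-g16 03:48:18Z (a): one fine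
  cell = `n_L/s₀` lattice units, cell pitch `20·K·s₀` fine cells); the steering target `kgTgt := pitch + (n + ρ − 1)/2 + (n + Δ)/2` (centres the arrival box
  `[f − (n+ρ−1), f]`, `f ∈ (tgt − n − Δ, tgt]` by `KGRows.kgN_spec`, at `pitch ± (n + Δ)/2`); the run length **`kgNv := kgN … kgTgt`**.
* §2 **`kgRows_of`**: `EqNumL κ Φ t p D g f`, the floor **`gFloorKG := 8·R′0 + 3·M_u + 6 ≤ g`** on the box slot and the split row `hρv : M_u + 1 + |v_L| ≤ n_L` give
  `KGRows n_L ℓ_L h_L v_L kgR kgρ (kgq qx) (kgW Wx)` — every other field is derived: `hn/hv` (`EqNumL`), `hlay/hρP/hρL` (the layer inequality `(M_L+1)(n_L+|h_L|) ≤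
  n_L(ℓ_L+1)` with `M_u ≤ M_L`, `960 ≤ M_L + 1`), `hR₁/hR₂` (`g ≤ M_L`, `M_L + 1 ≤ n_L`, **`M_L − 1 ≤ sL`** `ML_sub_one_le_kgSL`), `hq/hW` (by construction).
  Consumers ((R) p3-g16, (C) p5-g16) then read p5's discharges `KGRows.kgVals_ok₁/ok₂/split/park/last/kgN_spec` at `N := kgNv`.
* §3 `kgNv_le_div` (`kgN_le`), `kgTgt_nonneg`, **`kgNv_le : kgNv ≤ 20·K + 4`** (under the same floor; input of the (R-34) length budget `NegB.LfQ`, next file).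
The second axis (N-corridor, `KGYRows`, `tgt := (20·K·m)/U + centring`) is the sibling file `SkelFrmBParamsCorrKGY`.
builds on p205010 (kernel theorem, internal audit signed; external expert review pending) — nothing in this file uses p205010; NOTHING is claimed about the open
node `SamePDropOfSkeletonFrm₁`.
Lane `prim-bschramm`, seat `prim-bschramm-stmt` (gen 20); helper file (`--supports stmt-CriticalPhenomena-4575 --as helper`); ledger HOME/prim-bschramm-stmt/FRM-PARAMS.md.
[cite: KozmaNitzan2024, §4 Lemma 12 (pp. 23–25: the target box of a corridor; p. 26 (29): the cell pitch)] [cite: MartineauTassion2017, §4.3 Lemma 4.2 (steering)]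
-/

open scoped Classical

noncomputable section

namespace Summit.CriticalPhenomena.PercolationContinuityZ3.Theorems.Transplant

namespace PlanarSkeletonFrm

namespace NegB

open Literature.Probability.Percolation Literature.Probability.LatticeModels SimpleGraph
open SkelConc (Consts)
open Skelφ (shearUnit kgSL kgP kgΔ kgN kgFar KGRows)
open Neg

/-! ## §1 The inputs of record -/

section Inputs

variable (κ : Consts) {V : Type} [DecidableEq V] [Countable V] {G : SimpleGraph V} [G.LocallyFinite] (Φ : PlanarSkeletonFrm G) (t : V) (p : unitInterval)
  (D : Skelφ.StepI.DataNS V) (g f mk qx Wx : ℕ)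

/-- **The corridor displacement slot** `R′ := R′0` (the (S0) kit block's level displacement). [this work] -/
def kgR : ℕ := KS0.R'0 κ Φ t p D mk

/-- **The zone's planar radius** `ρ := M_u + 1`. [this work] -/
def kgρ {V : Type} (D : Skelφ.StepI.DataNS V) : ℕ := Mu D + 1

/-- **The phase-2 window slot** `W := sL.toNat + Wx` (`Wx` = the residual for the start-box row `hbW`). [this work] -/
def kgW : ℕ := (kgSL (nL κ Φ t p D g f) (ℓL κ Φ t p D g f) (hL κ Φ t p D g f)).toNat + Wx

/-- **The along start-extent slot** `q := 2·n_L + qx` (`qx` = the residual for the start-box row `haq`). [this work] -/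
def kgq : ℕ := 2 * nL κ Φ t p D g f + qx

/-- **The cell pitch along x′** in lattice units: `20·K·n_L`. [cite: KozmaNitzan2024, §4 p. 26 (29)] -/
def pitch : ℤ := 20 * (Neg.K κ : ℤ) * (nL κ Φ t p D g f : ℤ)

/-- **The steering target** `tgt := pitch + (n + ρ − 1)/2 + (n + Δ)/2`. [this work] -/
def kgTgt : ℤ :=
  pitch κ Φ t p D g f + ((nL κ Φ t p D g f : ℤ) + kgρ D - 1) / 2 +
    ((nL κ Φ t p D g f : ℤ) + kgΔ (vL κ Φ t p D g f) (kgR κ Φ t p D mk) (kgρ D)) / 2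

/-- **The run length of record** `N := kgN n_L ℓ_L h_L v_L R′ ρ q W tgt`. [this work] -/
def kgNv : ℕ :=
  kgN (nL κ Φ t p D g f) (ℓL κ Φ t p D g f) (hL κ Φ t p D g f) (vL κ Φ t p D g f) (kgR κ Φ t p D mk) (kgρ D) (kgq κ Φ t p D g f qx)
    (kgW κ Φ t p D g f Wx) (kgTgt κ Φ t p D g f mk)

/-- **The corridor floor on the box slot**: `8·R′0 + 3·M_u + 6`. [this work] -/
def gFloorKG : ℕ := 8 * KS0.R'0 κ Φ t p D mk + 3 * Mu D + 6

/-- `kgR = R′0`, `kgρ = M_u + 1`, `kgq = 2n_L + qx` (rfl). [folklore] -/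
theorem kg_inputs_eq : kgR κ Φ t p D mk = KS0.R'0 κ Φ t p D mk ∧ kgρ D = Mu D + 1 ∧ kgq κ Φ t p D g f qx = 2 * nL κ Φ t p D g f + qx := ⟨rfl, rfl, rfl⟩

end Inputs

/-! ## §2 The rows `KGRows` at the values -/

section Rows

variable (κ : Consts) {V : Type} [DecidableEq V] [Countable V] {G : SimpleGraph V} [G.LocallyFinite] (Φ : PlanarSkeletonFrm G) (t : V) (p : unitInterval)
  (D : Skelφ.StepI.DataNS V) (g f : ℕ)

/-- `(shearUnit n_L h_L : ℤ) = n_L + |h_L|`. [folklore] -/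
theorem shearUnit_cast : ((shearUnit (nL κ Φ t p D g f) (hL κ Φ t p D g f) : ℕ) : ℤ) = (nL κ Φ t p D g f : ℤ) + |hL κ Φ t p D g f| := by
  simp [Skelφ.shearUnit]

/-- **The layer inequality, spent once**: `M_L·(n_L + |h_L|) + |h_L| ≤ n_L·ℓ_L`. [folklore] -/
theorem ML_mul_U_le (hN : EqNumL κ Φ t p D g f) :
    (ML κ Φ t p D g : ℤ) * ((nL κ Φ t p D g f : ℤ) + |hL κ Φ t p D g f|) + |hL κ Φ t p D g f| ≤ (nL κ Φ t p D g f : ℤ) * ℓL κ Φ t p D g f := by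
  have h := hN.layer
  nlinarith [abs_nonneg (hL κ Φ t p D g f)]

/-- **`M_L − 1 ≤ sL`** (`sL = ⌊(nℓ − U + 1)/U⌋`, `U = n + |h|`). [folklore] -/
theorem ML_sub_one_le_kgSL (hN : EqNumL κ Φ t p D g f) :
    (ML κ Φ t p D g : ℤ) - 1 ≤ kgSL (nL κ Φ t p D g f) (ℓL κ Φ t p D g f) (hL κ Φ t p D g f) := by
  have h := ML_mul_U_le κ Φ t p D g f hN
  have hn1 : (1 : ℤ) ≤ nL κ Φ t p D g f := by exact_mod_cast (one_le_of_eqNumL κ Φ t p D g f hN).1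
  have ha : (0 : ℤ) ≤ |hL κ Φ t p D g f| := abs_nonneg _
  unfold Skelφ.kgSL
  rw [shearUnit_cast]
  apply Int.le_ediv_of_mul_le (by linarith)
  nlinarith

/-- `(n_L + |h_L| : ℕ) ≤ n_L·ℓ_L + 1` (`hlay`). [folklore] -/
theorem hlay_at (hN : EqNumL κ Φ t p D g f) :
    ((nL κ Φ t p D g f + (hL κ Φ t p D g f).natAbs : ℕ) : ℤ) ≤ (nL κ Φ t p D g f : ℤ) * ℓL κ Φ t p D g f + 1 := by
  have h := ML_mul_U_le κ Φ t p D g f hN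
  have h960 := slack_floor_le_ML κ Φ t p D g
  have hM : (959 : ℤ) ≤ ML κ Φ t p D g := by
    have : 959 ≤ ML κ Φ t p D g := by omega
    exact_mod_cast this
  have ha : (0 : ℤ) ≤ |hL κ Φ t p D g f| := abs_nonneg _
  have hn : (0 : ℤ) ≤ nL κ Φ t p D g f := by positivity
  push_cast
  nlinarith

/-- `M_u·U ≤ n_L·ℓ_L` in `ℕ` (for `hρP`, `hρL`). [folklore] -/
theorem Mu_mul_U_le (hN : EqNumL κ Φ t p D g f) :
    Mu D * shearUnit (nL κ Φ t p D g f) (hL κ Φ t p D g f) ≤ nL κ Φ t p D g f * ℓL κ Φ t p D g f := by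
  have h := ML_mul_U_le κ Φ t p D g f hN
  have hMu : ((Mu D : ℕ) : ℤ) ≤ ML κ Φ t p D g := by exact_mod_cast Mu_le_ML κ Φ t p D g
  have ha : (0 : ℤ) ≤ |hL κ Φ t p D g f| := abs_nonneg _
  have hn : (0 : ℤ) ≤ nL κ Φ t p D g f := by positivity
  have hZ : ((Mu D : ℕ) : ℤ) * ((nL κ Φ t p D g f : ℤ) + |hL κ Φ t p D g f|) ≤ (nL κ Φ t p D g f : ℤ) * ℓL κ Φ t p D g f := by nlinarith
  have hU := shearUnit_cast κ Φ t p D g f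
  have : ((Mu D * shearUnit (nL κ Φ t p D g f) (hL κ Φ t p D g f) : ℕ) : ℤ) ≤ ((nL κ Φ t p D g f * ℓL κ Φ t p D g f : ℕ) : ℤ) := by
    push_cast [hU]
    exact hZ
  exact_mod_cast this

/-- **THE ROWS AT THE VALUES.** `EqNumL`, the box-slot floor `gFloorKG ≤ g` and the split row `M_u + 1 + |v_L| ≤ n_L` give p5-g16's N-free rows `KGRows` at
`(n_L, ℓ_L, h_L, v_L, R′0, M_u + 1, 2n_L + qx, sL.toNat)`. [this work] -/
theorem kgRows_of (mk qx Wx : ℕ) (hN : EqNumL κ Φ t p D g f) (hg : gFloorKG κ Φ t p D mk ≤ g)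
    (hρv : ((Mu D : ℕ) : ℤ) + 1 + |vL κ Φ t p D g f| ≤ nL κ Φ t p D g f) :
    KGRows (nL κ Φ t p D g f) (ℓL κ Φ t p D g f) (hL κ Φ t p D g f) (vL κ Φ t p D g f) (kgR κ Φ t p D mk) (kgρ D) (kgq κ Φ t p D g f qx)
      (kgW κ Φ t p D g f Wx) := by
  obtain ⟨hn1, -⟩ := one_le_of_eqNumL κ Φ t p D g f hN
  have hnle := hN.n_le
  have hgML : g ≤ ML κ Φ t p D g := (ML_le_ML κ Φ t p D g).2
  have hsL := ML_sub_one_le_kgSL κ Φ t p D g f hN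
  have hMU := Mu_mul_U_le κ Φ t p D g f hN
  have hUpos : 0 < shearUnit (nL κ Φ t p D g f) (hL κ Φ t p D g f) := by unfold Skelφ.shearUnit; omega
  unfold gFloorKG at hg
  refine ⟨hn1, hN.v_le, hlay_at κ Φ t p D g f hN, ?_, ?_, ?_, ?_, ?_, ?_, ?_⟩
  · -- hR₁ : 4R′ + ρ + 1 ≤ sL
    unfold kgR kgρ
    have : ((8 * KS0.R'0 κ Φ t p D mk + 3 * Mu D + 6 : ℕ) : ℤ) ≤ ML κ Φ t p D g := by exact_mod_cast hg.trans hgML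
    push_cast at this ⊢
    linarith
  · -- hR₂ : 4R′ + 2ρ + 2 ≤ n
    unfold kgR kgρ
    have : ((ML κ Φ t p D g : ℕ) : ℤ) + 1 ≤ nL κ Φ t p D g f := hnle
    have hMn : ML κ Φ t p D g + 1 ≤ nL κ Φ t p D g f := by exact_mod_cast this
    omega
  · -- hρv
    unfold kgρ; push_cast; linarith
  · -- hρP : ρ ≤ P + 1
    unfold kgρ Skelφ.kgP
    have : Mu D ≤ nL κ Φ t p D g f * ℓL κ Φ t p D g f / shearUnit (nL κ Φ t p D g f) (hL κ Φ t p D g f) := (Nat.le_div_iff_mul_le hUpos).2 hMU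
    omega
  · -- hρL : ρ ≤ 3(nℓ)/U + 1
    unfold kgρ
    have h3 : Mu D * shearUnit (nL κ Φ t p D g f) (hL κ Φ t p D g f) ≤ 3 * (nL κ Φ t p D g f * ℓL κ Φ t p D g f) := by omega
    have : Mu D ≤ 3 * (nL κ Φ t p D g f * ℓL κ Φ t p D g f) / shearUnit (nL κ Φ t p D g f) (hL κ Φ t p D g f) := (Nat.le_div_iff_mul_le hUpos).2 h3
    omega
  · -- hq
    unfold kgq
    have := hN.v_le
    push_cast; linarith
  · -- hW
    unfold kgW
    have := Int.self_le_toNat (kgSL (nL κ Φ t p D g f) (ℓL κ Φ t p D g f) (hL κ Φ t p D g f))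
    have h0 : (0 : ℤ) ≤ ((kgSL (nL κ Φ t p D g f) (ℓL κ Φ t p D g f) (hL κ Φ t p D g f)).toNat : ℤ) := by positivity
    have h1 : (0 : ℤ) ≤ (Wx : ℤ) := by positivity
    push_cast
    linarith

/-- NON-VACUITY WITNESS of the row set (lead (g11) 2026-08-23T03:52:56Z standing order): p5-g16's rows `KGRows` hold at the sample
`(n, ℓ, hs, v, R′, ρ, q, W) := (40, 60, 3, 5, 2, 3, 90, 30)` (`sL = 54`, `P = 56`). [folklore] -/
example : KGRows 40 60 3 5 2 3 90 30 := by constructor <;> decide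

end Rows

/-! ## §3 The run length's bound -/

section RunLength

variable (κ : Consts) {V : Type} [DecidableEq V] [Countable V] {G : SimpleGraph V} [G.LocallyFinite] (Φ : PlanarSkeletonFrm G) (t : V) (p : unitInterval)
  (D : Skelφ.StepI.DataNS V) (g f mk qx Wx : ℕ)

/-- `kgNv ≤ ⌊tgt⌋₊ / n_L` (`kgN_le`). [folklore] -/
theorem kgNv_le_div : kgNv κ Φ t p D g f mk qx Wx ≤ (kgTgt κ Φ t p D g f mk).toNat / nL κ Φ t p D g f := Skelφ.kgN_le _

/-- `0 ≤ pitch` and `0 ≤ tgt`. [folklore] -/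
theorem kgTgt_nonneg : 0 ≤ pitch κ Φ t p D g f ∧ 0 ≤ kgTgt κ Φ t p D g f mk := by
  have hp : 0 ≤ pitch κ Φ t p D g f := by unfold pitch; positivity
  refine ⟨hp, ?_⟩
  unfold kgTgt Skelφ.kgΔ kgρ
  have ha : (0 : ℤ) ≤ |vL κ Φ t p D g f| := abs_nonneg _
  have h1 : (0 : ℤ) ≤ ((nL κ Φ t p D g f : ℤ) + ((Mu D + 1 : ℕ) : ℤ) - 1) / 2 := Int.ediv_nonneg (by push_cast; omega) (by norm_num)
  have h2 : (0 : ℤ) ≤ ((nL κ Φ t p D g f : ℤ) + (8 * ((kgR κ Φ t p D mk : ℕ) : ℤ) + 7 * ((Mu D + 1 : ℕ) : ℤ) + |vL κ Φ t p D g f|)) / 2 :=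
    Int.ediv_nonneg (by positivity) (by norm_num)
  linarith

/-- **`kgNv ≤ 20·K + 4`**: one cell pitch holds at most `20K + 4` run steps of `n_L` (under `EqNumL` and the box-slot floor; the centring offsets are `≤ 4·n_L`).
[this work] -/
theorem kgNv_le (hN : EqNumL κ Φ t p D g f) (hg : gFloorKG κ Φ t p D mk ≤ g) : kgNv κ Φ t p D g f mk qx Wx ≤ 20 * Neg.K κ + 4 := by
  refine (kgNv_le_div κ Φ t p D g f mk qx Wx).trans ?_
  obtain ⟨hn1, -⟩ := one_le_of_eqNumL κ Φ t p D g f hN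
  have hnle := hN.n_le
  have hv := hN.v_le
  have hgML : g ≤ ML κ Φ t p D g := (ML_le_ML κ Φ t p D g).2
  unfold gFloorKG at hg
  have hfl : ((8 * KS0.R'0 κ Φ t p D mk + 3 * Mu D + 6 : ℕ) : ℤ) + 1 ≤ nL κ Φ t p D g f := by
    have : ((8 * KS0.R'0 κ Φ t p D mk + 3 * Mu D + 6 : ℕ) : ℤ) ≤ ML κ Φ t p D g := by exact_mod_cast hg.trans hgML
    linarith
  push_cast at hfl
  have htgt : kgTgt κ Φ t p D g f mk ≤ (nL κ Φ t p D g f : ℤ) * (20 * Neg.K κ + 4) := by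
    unfold kgTgt pitch Skelφ.kgΔ kgρ kgR
    have e1 := Int.ediv_mul_le ((nL κ Φ t p D g f : ℤ) + ((Mu D + 1 : ℕ) : ℤ) - 1) (b := 2) (by norm_num)
    have e2 := Int.ediv_mul_le ((nL κ Φ t p D g f : ℤ) + (8 * ((KS0.R'0 κ Φ t p D mk : ℕ) : ℤ) + 7 * ((Mu D + 1 : ℕ) : ℤ) + |vL κ Φ t p D g f|)) (b := 2)
      (by norm_num)
    push_cast at e1 e2 ⊢
    nlinarith
  have h0 := (kgTgt_nonneg κ Φ t p D g f mk).2
  have hcast : (((kgTgt κ Φ t p D g f mk).toNat : ℕ) : ℤ) ≤ ((nL κ Φ t p D g f * (20 * Neg.K κ + 4) : ℕ) : ℤ) := by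
    rw [Int.toNat_of_nonneg h0]; push_cast; exact htgt
  exact Nat.div_le_of_le_mul (by exact_mod_cast hcast)

end RunLength

end NegB

end PlanarSkeletonFrm

end Summit.CriticalPhenomena.PercolationContinuityZ3.Theorems.Transplant

end
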